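import Mathlib
import Literature.AlgebraicGeometry.Resolution.PlaneGermBlowup
import Literature.AlgebraicGeometry.Resolution.PlaneGermBlowupCalculus
import Literature.AlgebraicGeometry.Resolution.FormalShear

/-!
# `WeightedInvariant.LocalWeightedDrop`, line `hasse-ridge-face-selection`: exceptional and smooth calculus

Crux item stmt-ResolutionOfSingularities-8899 (route `ResolutionOfSingularities/WeightedInvariant`),
skeleton v14 of the line `hasse-ridge-face-selection`, stub `stub_exceptionalSmoothCalculus`, PROVED here
(statement verbatim from the ledger registration).

**Statement (folklore computations in `k[[x, y]]`, any field `k`; `x = X 0`, `y = X 1`).**  For the two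
charts of the point blow-up `PlaneGerm.dirChart t = (x, x (t + y))`, `PlaneGerm.vertChart = (x y, x)`, a unit
`v` (`v(0) ≠ 0`) and a smooth germ `L` transversal to `x = 0` (`L(0) = 0`, `∂L/∂y(0) ≠ 0`):
(C1) `(v xᵃ yᶜ)(x, x(t + y)) = x^{a+c} · unit` for `t ≠ 0`; (C2) `(v xᵃ yᶜ)(x, x y) = x^{a+c} · (unit · yᶜ)`;
(C3) `(v xᵃ yᶜ)(x y, x) = x^{a+c} · (unit · yᵃ)`; (C4) `ord (v xᵃ yᶜ Lⁿ) = a + c + n`;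
(C5) `v xᵃ yᶜ` and `v x Lⁿ` have normal-crossing support (`PlaneGerm.IsNC`);
(C6) `L(x, x(t + y)) = x · L'` with `∂L'/∂y(0) = ∂L/∂y(0)`, `L'(0) = ∂L/∂x(0) + t ∂L/∂y(0)`, and for
`t = 0` the `xⁿ`-coefficient of `L'` is the `x^{n+1}`-coefficient of `L`; (C7) `L(x y, x) = x · unit`.

**Proof.**  (C1)–(C3): `subst` is a ring map (`MvPowerSeries.subst_mul/pow/X`) and substitutions by
constant-free families preserve constant coefficients
(`FormalShear.constantCoeff_subst_eq_of_constantCoeff_eq_zero`); the bracket in (C1) has constant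
coefficient `v(0) tᶜ ≠ 0`.  (C4): orders add in the domain `k[[x, y]]` (`MvPowerSeries.order_mul`),
`ord v = 0`, `ord xᵃ = a`, `ord L = 1` (`≥ 1` from `L(0) = 0`, `≤ 1` from the `y`-coefficient),
`ord Lⁿ = n ord L` (`FormalShear.order_pow_eq`).  (C5): the identity coordinates for `v xᵃ yᶜ`; for
`v x Lⁿ` the graph form `FormalShear.graph` gives a shear `(x, y + ψ(x))` (constant-free, linear part of
determinant `1`) carrying `L` to `y · W`, `W` a unit, hence `v x Lⁿ` to `(v∘shear · Wⁿ) · x · yⁿ`.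
(C6), (C7): `x ∣ L∘chart` (`PlaneGerm.X_pow_dvd_subst`, `ord L ≥ 1`), and the coefficients of the quotient
are read off through `PlaneGerm.subst_dirChart` (slope chart = shear `(x, y + t x)` then `(x, x y)`),
`PlaneGerm.coeff_subst_blow`, `PlaneGerm.coeff_subst_vertChart`, the degree-one coefficients of a shear
(`CobordantArc.coeff_degree_one_subst`, `FormalShear.coeff_single_one_shear`) and `FormalShear.shear_zero`.
-/

set_option linter.dupNamespace false -- mandated namespace of this single-conjunct summit

namespace Summit.ResolutionOfSingularities.ResolutionOfSingularities.Theorems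

open Literature.AlgebraicGeometry.Resolution

namespace ExceptionalSmoothCalculus

open MvPowerSeries

variable {k : Type} [Field k]

/-! ### (C1)–(C3): transforms of the exceptional part `v · xᵃ · yᶜ` -/

/-- (C1) At a point of non-zero slope `t`: `(v xᵃ yᶜ)(x, x(t + y)) = x^{a+c} · [(v∘Φ) (t + y)ᶜ]`, and the
bracket is a unit. -/
theorem exceptional_dirChart (t : k) {v : MvPowerSeries (Fin 2) k} (a c : ℕ)
    (hv : constantCoeff v ≠ 0) (ht : t ≠ 0) :
    ∃ v' : MvPowerSeries (Fin 2) k, constantCoeff v' ≠ 0 ∧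
      subst (PlaneGerm.dirChart t) (v * X 0 ^ a * X 1 ^ c) = X 0 ^ (a + c) * v' := by
  have hΦ := PlaneGerm.hasSubst_dirChart (k := k) t
  refine ⟨subst (PlaneGerm.dirChart t) v * (C t + X 1) ^ c, ?_, ?_⟩
  · rw [map_mul, map_pow, map_add, constantCoeff_C, constantCoeff_X, add_zero,
      FormalShear.constantCoeff_subst_eq_of_constantCoeff_eq_zero _ (PlaneGerm.constantCoeff_dirChart t) v]
    exact mul_ne_zero hv (pow_ne_zero _ ht)
  · rw [subst_mul hΦ, subst_mul hΦ, subst_pow hΦ, subst_pow hΦ, subst_X hΦ, subst_X hΦ,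
      PlaneGerm.dirChart_zero, PlaneGerm.dirChart_one, mul_pow]
    ring

/-- (C2) At the point of slope `0`: `(v xᵃ yᶜ)(x, x y) = x^{a+c} · ((v∘Φ) · yᶜ)`. -/
theorem exceptional_dirChart_zero {v : MvPowerSeries (Fin 2) k} (a c : ℕ) (hv : constantCoeff v ≠ 0) :
    ∃ v' : MvPowerSeries (Fin 2) k, constantCoeff v' ≠ 0 ∧
      subst (PlaneGerm.dirChart (0 : k)) (v * X 0 ^ a * X 1 ^ c) = X 0 ^ (a + c) * (v' * X 1 ^ c) := by
  have hΦ := PlaneGerm.hasSubst_dirChart (k := k) 0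
  refine ⟨subst (PlaneGerm.dirChart (0 : k)) v, ?_, ?_⟩
  · rwa [FormalShear.constantCoeff_subst_eq_of_constantCoeff_eq_zero _ (PlaneGerm.constantCoeff_dirChart 0) v]
  · rw [subst_mul hΦ, subst_mul hΦ, subst_pow hΦ, subst_pow hΦ, subst_X hΦ, subst_X hΦ,
      PlaneGerm.dirChart_zero, PlaneGerm.dirChart_one, map_zero, zero_add]
    ring

/-- (C3) At the vertical point: `(v xᵃ yᶜ)(x y, x) = x^{a+c} · ((v∘Φ) · yᵃ)`. -/
theorem exceptional_vertChart {v : MvPowerSeries (Fin 2) k} (a c : ℕ) (hv : constantCoeff v ≠ 0) :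
    ∃ v' : MvPowerSeries (Fin 2) k, constantCoeff v' ≠ 0 ∧
      subst (PlaneGerm.vertChart k) (v * X 0 ^ a * X 1 ^ c) = X 0 ^ (a + c) * (v' * X 1 ^ a) := by
  have hΦ := PlaneGerm.hasSubst_vertChart (k := k)
  refine ⟨subst (PlaneGerm.vertChart k) v, ?_, ?_⟩
  · rwa [FormalShear.constantCoeff_subst_eq_of_constantCoeff_eq_zero _ PlaneGerm.constantCoeff_vertChart v]
  · rw [subst_mul hΦ, subst_mul hΦ, subst_pow hΦ, subst_pow hΦ, subst_X hΦ, subst_X hΦ,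
      PlaneGerm.vertChart_zero, PlaneGerm.vertChart_one]
    ring

/-! ### (C4): orders of the model germs -/

/-- A unit has order `0`. -/
theorem order_of_constantCoeff_ne_zero {v : MvPowerSeries (Fin 2) k} (hv : constantCoeff v ≠ 0) :
    v.order = 0 := by
  by_contra h
  exact hv (order_ne_zero_iff_constCoeff_eq_zero.mp h)

/-- `ord (X i)ᵃ = a`. -/
theorem order_X_pow (i : Fin 2) (a : ℕ) : ((X i : MvPowerSeries (Fin 2) k) ^ a).order = a := by
  rw [X_pow_eq, order_monomial_of_ne_zero one_ne_zero, Finsupp.degree_single]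

/-- A smooth germ transversal to `x = 0` has order `1`. -/
theorem order_smooth {L : MvPowerSeries (Fin 2) k} (hL0 : constantCoeff L = 0)
    (hL1 : coeff (Finsupp.single 1 1) L ≠ 0) : L.order = 1 := by
  apply le_antisymm
  · have h := order_le hL1
    rwa [Finsupp.degree_single, Nat.cast_one] at h
  · exact one_le_order_iff_constCoeff_eq_zero.mpr hL0

/-- (C4) `ord (v xᵃ yᶜ Lⁿ) = a + c + n`. -/
theorem order_model {v L : MvPowerSeries (Fin 2) k} (a c n : ℕ) (hv : constantCoeff v ≠ 0)
    (hL0 : constantCoeff L = 0) (hL1 : coeff (Finsupp.single 1 1) L ≠ 0) :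
    (v * X 0 ^ a * X 1 ^ c * L ^ n).order = ((a + c + n : ℕ) : ℕ∞) := by
  rw [order_mul, order_mul, order_mul, order_of_constantCoeff_ne_zero hv, order_X_pow, order_X_pow,
    FormalShear.order_pow_eq, order_smooth hL0 hL1, zero_add, mul_one, Nat.cast_add, Nat.cast_add]

/-! ### (C5): model normal crossings -/

/-- (C5a) `v xᵃ yᶜ` has normal-crossing support (identity coordinates). -/
theorem isNC_monomial {v : MvPowerSeries (Fin 2) k} (a c : ℕ) (hv : constantCoeff v ≠ 0) :
    PlaneGerm.IsNC (v * X 0 ^ a * X 1 ^ c) := by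
  -- adapted from `BlowupSuccessorToolkit.isNC_X_mul`
  classical
  refine ⟨X, v, a, c, fun i => constantCoeff_X i, ?_, hv, ?_⟩
  · simp [Matrix.det_fin_two, coeff_index_single_X]
  · rw [subst_self]
    rfl

/-- (C5b) `v · x · Lⁿ` has normal-crossing support: the graph shear of `L` carries it to
`(unit) · x · yⁿ`. -/
theorem isNC_X_mul_pow {v L : MvPowerSeries (Fin 2) k} (n : ℕ) (hv : constantCoeff v ≠ 0)
    (hL0 : constantCoeff L = 0) (hL1 : coeff (Finsupp.single 1 1) L ≠ 0) :
    PlaneGerm.IsNC (v * X 0 * L ^ n) := by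
  classical
  obtain ⟨ψ, W, hψX, hψ0, hW, hLW⟩ := FormalShear.graph L hL0 hL1
  have hΦ := FormalShear.hasSubst_shear hψ0
  refine ⟨![X 0, X 1 + ψ], subst ![X 0, X 1 + ψ] v * W ^ n, 1, n, FormalShear.constantCoeff_shear hψ0,
    ?_, ?_, ?_⟩
  · rw [Matrix.det_fin_two]
    simp [coeff_index_single_X, FormalShear.coeff_single_one_of_noY hψX]
  · rw [map_mul, map_pow,
      FormalShear.constantCoeff_subst_eq_of_constantCoeff_eq_zero _ (FormalShear.constantCoeff_shear hψ0) v]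
    exact mul_ne_zero hv (pow_ne_zero _ hW)
  · rw [subst_mul hΦ, subst_mul hΦ, subst_pow hΦ, subst_X hΦ, hLW]
    show subst ![X 0, X 1 + ψ] v * X 0 * (X 1 * W) ^ n = _
    ring

/-! ### (C6), (C7): a smooth branch transversal to `x = 0` under the two charts -/

/-- The `x · (monomial e)`-coefficient of `x · φ` is the `e`-coefficient of `φ`. -/
theorem coeff_single_add_X_mul (e : Fin 2 →₀ ℕ) (φ : MvPowerSeries (Fin 2) k) :
    coeff (Finsupp.single 0 1 + e) (X 0 * φ) = coeff e φ := by
  rw [X_def, coeff_add_monomial_mul, one_mul]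

/-- Coefficients along `(x, x y)`, with the target exponent given by its coordinates. -/
theorem coeff_subst_blow' (g : MvPowerSeries (Fin 2) k) {d : Fin 2 →₀ ℕ} (e : Fin 2 →₀ ℕ)
    (h0 : e 0 = d 0 + d 1) (h1 : e 1 = d 1) :
    coeff e (subst (![X 0, X 0 * X 1] : Fin 2 → MvPowerSeries (Fin 2) k) g) = coeff d g := by
  have he : e = Finsupp.single 0 (d 0 + d 1) + Finsupp.single 1 (d 1) := by
    ext i
    fin_cases i
    · simpa using h0
    · simpa using h1
  rw [he]
  exact PlaneGerm.coeff_subst_blow g d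

/-- Coefficients along the vertical chart, with the target exponent given by its coordinates. -/
theorem coeff_subst_vertChart' (g : MvPowerSeries (Fin 2) k) {d : Fin 2 →₀ ℕ} (e : Fin 2 →₀ ℕ)
    (h0 : e 0 = d 0 + d 1) (h1 : e 1 = d 0) :
    coeff e (subst (PlaneGerm.vertChart k) g) = coeff d g := by
  have he : e = Finsupp.single 0 (d 0 + d 1) + Finsupp.single 1 (d 0) := by
    ext i
    fin_cases i
    · simpa using h0
    · simpa using h1
  rw [he]
  exact PlaneGerm.coeff_subst_vertChart g d

/-- `t · x` is constant-free. -/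
theorem constantCoeff_C_mul_X (t : k) : constantCoeff (C t * X 0 : MvPowerSeries (Fin 2) k) = 0 := by
  rw [map_mul, constantCoeff_X, mul_zero]

/-- The `x`-coefficient after the shear `(x, y + t x)`: `∂/∂x (L(x, y + t x))(0) = ∂L/∂x(0) + t ∂L/∂y(0)`. -/
theorem coeff_single_zero_one_shear (t : k) (L : MvPowerSeries (Fin 2) k) :
    coeff (Finsupp.single 0 1) (subst (![X 0, X 1 + C t * X 0] : Fin 2 → MvPowerSeries (Fin 2) k) L) =
      coeff (Finsupp.single 0 1) L + t * coeff (Finsupp.single 1 1) L := by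
  classical
  rw [CobordantArc.coeff_degree_one_subst _ (PlaneGerm.constantCoeff_shearX t) L _
    (Finsupp.degree_single _ _), Fin.sum_univ_two]
  have h0 : coeff (Finsupp.single 0 1)
      ((![X 0, X 1 + C t * X 0] : Fin 2 → MvPowerSeries (Fin 2) k) 0) = 1 := by
    show coeff (Finsupp.single 0 1) (X 0 : MvPowerSeries (Fin 2) k) = 1
    exact coeff_index_single_self_X 0
  have h1 : coeff (Finsupp.single 0 1)
      ((![X 0, X 1 + C t * X 0] : Fin 2 → MvPowerSeries (Fin 2) k) 1) = t := by
    show coeff (Finsupp.single 0 1) (X 1 + C t * X 0 : MvPowerSeries (Fin 2) k) = t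
    rw [map_add, coeff_C_mul, coeff_index_single_self_X, coeff_index_single_X,
      if_neg (show (0 : Fin 2) ≠ 1 by decide), zero_add, mul_one]
  rw [h0, h1]
  ring

/-- (C6) `L(x, x(t + y)) = x · L'` with `∂L'/∂y(0) = ∂L/∂y(0)`, `L'(0) = ∂L/∂x(0) + t ∂L/∂y(0)`, and for
`t = 0`: the `xⁿ`-coefficient of `L'` is the `x^{n+1}`-coefficient of `L`. -/
theorem smooth_dirChart (t : k) {L : MvPowerSeries (Fin 2) k} (hL0 : constantCoeff L = 0) :
    ∃ L' : MvPowerSeries (Fin 2) k, subst (PlaneGerm.dirChart t) L = X 0 * L' ∧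
      coeff (Finsupp.single 1 1) L' = coeff (Finsupp.single 1 1) L ∧
      constantCoeff L' = coeff (Finsupp.single 0 1) L + t * coeff (Finsupp.single 1 1) L ∧
      (t = 0 → ∀ n : ℕ, coeff (Finsupp.single 0 n) L' = coeff (Finsupp.single 0 (n + 1)) L) := by
  obtain ⟨L', hL'⟩ := PlaneGerm.X_pow_dvd_subst (PlaneGerm.hasSubst_dirChart t)
    (PlaneGerm.X_dvd_dirChart t) (b := L) (m := 1)
    (by rw [Nat.cast_one]; exact one_le_order_iff_constCoeff_eq_zero.mpr hL0)
  rw [pow_one] at hL'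
  -- the coefficients of `L'` are the shifted coefficients of `L(x, x(t + y)) = (shear_t L)(x, x y)`
  have hc : ∀ e : Fin 2 →₀ ℕ, coeff e L' = coeff (Finsupp.single 0 1 + e)
      (subst (![X 0, X 0 * X 1] : Fin 2 → MvPowerSeries (Fin 2) k)
        (subst (![X 0, X 1 + C t * X 0] : Fin 2 → MvPowerSeries (Fin 2) k) L)) := by
    intro e
    rw [← PlaneGerm.subst_dirChart, hL', coeff_single_add_X_mul]
  -- `t x` has no `y`-monomials (cf. `PersistentOrderPower.noY_C_mul_X`)
  have hψX : ∀ e : Fin 2 →₀ ℕ, e 1 ≠ 0 → coeff e (C t * X 0 : MvPowerSeries (Fin 2) k) = 0 := by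
    intro e he
    rw [coeff_C_mul, coeff_X, if_neg, mul_zero]
    rintro rfl
    simp at he
  refine ⟨L', hL', ?_, ?_, ?_⟩
  · rw [hc, coeff_subst_blow' _ (d := Finsupp.single 1 1) _ (by simp) (by simp),
      FormalShear.coeff_single_one_shear hψX (constantCoeff_C_mul_X t)]
  · rw [← coeff_zero_eq_constantCoeff_apply, hc, add_zero,
      coeff_subst_blow' _ (d := Finsupp.single 0 1) _ (by simp) (by simp), coeff_single_zero_one_shear]
  · rintro rfl n
    have hshear : subst (![X 0, X 1 + C (0 : k) * X 0] : Fin 2 → MvPowerSeries (Fin 2) k) L = L := by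
      rw [map_zero, zero_mul]
      exact FormalShear.shear_zero L
    rw [hc, hshear, coeff_subst_blow' _ (d := Finsupp.single 0 (n + 1)) _ (by simp; omega) (by simp)]

/-- (C7) `L(x y, x) = x · w` with `w(0) = ∂L/∂y(0) ≠ 0`. -/
theorem smooth_vertChart {L : MvPowerSeries (Fin 2) k} (hL0 : constantCoeff L = 0)
    (hL1 : coeff (Finsupp.single 1 1) L ≠ 0) :
    ∃ w : MvPowerSeries (Fin 2) k, constantCoeff w ≠ 0 ∧ subst (PlaneGerm.vertChart k) L = X 0 * w := by
  obtain ⟨w, hw⟩ := PlaneGerm.X_pow_dvd_subst PlaneGerm.hasSubst_vertChart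
    PlaneGerm.X_dvd_vertChart (b := L) (m := 1)
    (by rw [Nat.cast_one]; exact one_le_order_iff_constCoeff_eq_zero.mpr hL0)
  rw [pow_one] at hw
  refine ⟨w, ?_, hw⟩
  rw [← coeff_zero_eq_constantCoeff_apply, ← coeff_single_add_X_mul 0 w, ← hw, add_zero,
    coeff_subst_vertChart' _ (d := Finsupp.single 1 1) _ (by simp) (by simp)]
  exact hL1

end ExceptionalSmoothCalculus

open ExceptionalSmoothCalculus in
/-- EXCEPTIONAL AND SMOOTH CALCULUS (folklore computations in `k[[x, y]]`, any field).  With `v` a unit and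
`L` smooth and transversal to `x = 0`: (C1)–(C3) the transforms of the exceptional part `v · xᵃ · yᶜ` in the
chart of slope `t ≠ 0`, of slope `0`, and the vertical chart; (C4) `ord (v xᵃ yᶜ Lⁿ) = a + c + n`;
(C5) `v xᵃ yᶜ` and `v x Lⁿ` have normal-crossing support; (C6) `L(x, x(t + y)) = x · L'` with the
first-order data of `L'`, and for `t = 0` the pure-`x` coefficients shift by one; (C7) `L(x y, x) = x · unit`. -/
theorem stub_exceptionalSmoothCalculus : ∀ (k : Type) [Field k],
    (∀ (t : k) (v : MvPowerSeries (Fin 2) k) (a c : ℕ), MvPowerSeries.constantCoeff v ≠ 0 → t ≠ 0 →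
      ∃ v' : MvPowerSeries (Fin 2) k, MvPowerSeries.constantCoeff v' ≠ 0 ∧
        MvPowerSeries.subst (PlaneGerm.dirChart t) (v * MvPowerSeries.X 0 ^ a * MvPowerSeries.X 1 ^ c) =
          MvPowerSeries.X 0 ^ (a + c) * v') ∧
    (∀ (v : MvPowerSeries (Fin 2) k) (a c : ℕ), MvPowerSeries.constantCoeff v ≠ 0 →
      ∃ v' : MvPowerSeries (Fin 2) k, MvPowerSeries.constantCoeff v' ≠ 0 ∧
        MvPowerSeries.subst (PlaneGerm.dirChart 0) (v * MvPowerSeries.X 0 ^ a * MvPowerSeries.X 1 ^ c) =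
          MvPowerSeries.X 0 ^ (a + c) * (v' * MvPowerSeries.X 1 ^ c)) ∧
    (∀ (v : MvPowerSeries (Fin 2) k) (a c : ℕ), MvPowerSeries.constantCoeff v ≠ 0 →
      ∃ v' : MvPowerSeries (Fin 2) k, MvPowerSeries.constantCoeff v' ≠ 0 ∧
        MvPowerSeries.subst (PlaneGerm.vertChart k) (v * MvPowerSeries.X 0 ^ a * MvPowerSeries.X 1 ^ c) =
          MvPowerSeries.X 0 ^ (a + c) * (v' * MvPowerSeries.X 1 ^ a)) ∧
    (∀ (v L : MvPowerSeries (Fin 2) k) (a c n : ℕ), MvPowerSeries.constantCoeff v ≠ 0 →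
      MvPowerSeries.constantCoeff L = 0 → MvPowerSeries.coeff (Finsupp.single 1 1) L ≠ 0 →
      (v * MvPowerSeries.X 0 ^ a * MvPowerSeries.X 1 ^ c * L ^ n).order = ((a + c + n : ℕ) : ℕ∞)) ∧
    (∀ (v : MvPowerSeries (Fin 2) k) (a c : ℕ), MvPowerSeries.constantCoeff v ≠ 0 →
      PlaneGerm.IsNC (v * MvPowerSeries.X 0 ^ a * MvPowerSeries.X 1 ^ c)) ∧
    (∀ (v L : MvPowerSeries (Fin 2) k) (n : ℕ), MvPowerSeries.constantCoeff v ≠ 0 →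
      MvPowerSeries.constantCoeff L = 0 → MvPowerSeries.coeff (Finsupp.single 1 1) L ≠ 0 →
      PlaneGerm.IsNC (v * MvPowerSeries.X 0 * L ^ n)) ∧
    (∀ (t : k) (L : MvPowerSeries (Fin 2) k), MvPowerSeries.constantCoeff L = 0 →
      MvPowerSeries.coeff (Finsupp.single 1 1) L ≠ 0 →
      ∃ L' : MvPowerSeries (Fin 2) k, MvPowerSeries.subst (PlaneGerm.dirChart t) L = MvPowerSeries.X 0 * L' ∧
        MvPowerSeries.coeff (Finsupp.single 1 1) L' = MvPowerSeries.coeff (Finsupp.single 1 1) L ∧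
        MvPowerSeries.constantCoeff L' =
          MvPowerSeries.coeff (Finsupp.single 0 1) L + t * MvPowerSeries.coeff (Finsupp.single 1 1) L ∧
        (t = 0 → ∀ n : ℕ, MvPowerSeries.coeff (Finsupp.single 0 n) L' = MvPowerSeries.coeff (Finsupp.single 0 (n + 1)) L)) ∧
    (∀ (L : MvPowerSeries (Fin 2) k), MvPowerSeries.constantCoeff L = 0 →
      MvPowerSeries.coeff (Finsupp.single 1 1) L ≠ 0 →
      ∃ w : MvPowerSeries (Fin 2) k, MvPowerSeries.constantCoeff w ≠ 0 ∧
        MvPowerSeries.subst (PlaneGerm.vertChart k) L = MvPowerSeries.X 0 * w) := by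
  intro k _
  exact ⟨fun t v a c hv ht => exceptional_dirChart t a c hv ht,
    fun v a c hv => exceptional_dirChart_zero a c hv,
    fun v a c hv => exceptional_vertChart a c hv,
    fun v L a c n hv hL0 hL1 => order_model a c n hv hL0 hL1,
    fun v a c hv => isNC_monomial a c hv,
    fun v L n hv hL0 hL1 => isNC_X_mul_pow n hv hL0 hL1,
    fun t L hL0 _ => smooth_dirChart t hL0,
    fun L hL0 hL1 => smooth_vertChart hL0 hL1⟩

end Summit.ResolutionOfSingularities.ResolutionOfSingularities.Theorems
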